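import Literature.NumberTheory.EllipticCurves.ZpCorankQuasiIso
import Mathlib.RingTheory.RootsOfUnity.Lemmas
import Mathlib.RingTheory.Polynomial.Cyclotomic.Roots
import Mathlib.RingTheory.RootsOfUnity.Complex
import Mathlib.NumberTheory.Padics.PadicVal.Basic
import HarnessLib

/-!
# The `ℤ_p`-corank of a `ℤ[C_p]`-module and of its invariants have the same parity (`p` odd)

Pure algebra for the corank formula `Literature.NumberTheory.EllipticCurves.zpCorank A p =
dim_{𝔽_p} A[p] − dim_{𝔽_p} A/pA` (file `Selmer`; meaningful for `p`-primary groups with finite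
`p`-torsion). It is the representation-theoretic heart of T. Dokchitser, V. Dokchitser,
*On the Birch–Swinnerton-Dyer quotients modulo squares*, Ann. of Math. 172 (2010), Cor. 4.15:
"A cyclic group of order `p` has only two `ℚ_p`-irreducible `p`-adic representations, the trivial
one and one of dimension `p − 1`. Thus, the parity of the `p^∞`-Selmer rank is unchanged in
cyclic `p`-extensions" — read at the level of discrete `p`-primary groups with an automorphism
`c` of order `p`, where "`dim X = dim X^G + (p - 1) m_ρ`" becomes:

* `even_zpCorank_of_geom_sum_eq_zero` — if `A` is `p`-primary with `A[p]` finite, `p` is an odd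
  prime, and `c ∈ End(A)` satisfies `1 + c + ⋯ + c^{p-1} = 0` (so that `A` is a module over
  `ℤ[C_p]/(Φ_p) = ℤ[ζ_p]`), then `zpCorank A p` is even;
* `zpCorank_mod_two_eq_of_pow_eq_id` — for an endomorphism `c` with `c^p = 1` of a
  `p`-primary `A'` with finite `p`-torsion, `zpCorank A' p ≡ zpCorank A'^{⟨c⟩} p (mod 2)`
  (apply the first to `A = (1 - c) A'`, killed by `Φ_p(c)`, along
  `0 → ker (1 - c) → A' → (1 - c) A' → 0`).

The proof of the first is elementary counting: for an endomorphism `f` of `A` with finite kernel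
and cokernel put `N(f) = #ker f / (A : f A) ∈ ℚ`; then `N(g ∘ f) = N(g) N(f)`
(`kerCokerRatio_comp`), `N(u) = 1` for an automorphism, and `N(p) = #A[p] / #(A/pA) =
p ^ zpCorank A p` (`pow_zpCorank_mul_natCard_modN`). In `ℤ[X]`,
`∏_{k=1}^{p-1} (1 - X^k) ≡ p (mod Φ_p)` (`IsPrimitiveRoot.prod_one_sub_pow_eq_order`, Gauss) and
`1 - X^k = (1 - X) e_k`, `e_k = 1 + X + ⋯ + X^{k-1}`, so on `A`:
`p = (1 - c)^{p-1} ∏_{k=1}^{p-1} e_k(c)`; and `e_{p-k}(c) = -c^{p-k} e_k(c)` since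
`e_{p-k} + X^{p-k} e_k = Φ_p`. Hence `N(e_{p-k}(c)) = N(e_k(c))` and
`p ^ zpCorank A p = N(p) = (N(1 - c)^{(p-1)/2} ∏_{k ≤ (p-1)/2} N(e_k(c)))²` is the square of a
rational number, so the corank is even. (The sharper `(p - 1) ∣ zpCorank A p` would need the
cyclotomic units `e_k(ζ_p) ∈ ℤ[ζ_p]ˣ`; parity is all Cor. 4.15 uses.) Everything here is proved.

## References

* T. Dokchitser, V. Dokchitser, Ann. of Math. 172 (2010), Lemma 4.14 and Cor. 4.15.
  [DokchitserDokchitserAnnals2010]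
* R. Greenberg, *Iwasawa theory for elliptic curves*, LNM 1716 (1999), §1 (coranks).
  [Greenberg1999LNM]
-/

noncomputable section

open scoped AddSubgroup

open Function Polynomial Finset

namespace Literature.NumberTheory.EllipticCurves

/-! ## The kernel–cokernel ratio of an endomorphism -/

section KerCoker

variable {A : Type*} [AddCommGroup A]

/-- The ratio `N(f) = #ker f / (A : f A)` of an endomorphism of an abelian group (meaningful
when kernel and cokernel are finite; a multiplicative Herbrand-type index). [folklore] -/
def kerCokerRatio (f : A →+ A) : ℚ :=
  (Nat.card f.ker : ℚ) / (f.range.index : ℚ)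

/-- Finiteness of kernel and cokernel of an endomorphism, as the non-vanishing of `#ker f` and
`(A : f A)` (`Nat.card` and `AddSubgroup.index` vanish exactly in the infinite case). [folklore] -/
structure FinKerCoker (f : A →+ A) : Prop where
  /-- the kernel is finite -/
  card_ker_ne_zero : Nat.card f.ker ≠ 0
  /-- the image has finite index -/
  index_ne_zero : f.range.index ≠ 0

/-- `#ker (g ∘ f) = #ker f · #(ker g ∩ im f)`: `f` maps `ker (g ∘ f)` onto `ker g ∩ im f` with
kernel `ker f`. [folklore] -/
theorem natCard_ker_comp (f g : A →+ A) :
    Nat.card (g.comp f).ker = Nat.card f.ker * Nat.card ↥(g.ker ⊓ f.range) := by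
  set φ : (g.comp f).ker →+ A := f.comp (g.comp f).ker.subtype with hφ
  have hrange : φ.range = g.ker ⊓ f.range := by
    ext x
    constructor
    · rintro ⟨⟨a, ha⟩, rfl⟩
      rw [AddMonoidHom.mem_ker, AddMonoidHom.comp_apply] at ha
      exact ⟨ha, ⟨a, rfl⟩⟩
    · rintro ⟨hx, ⟨a, rfl⟩⟩
      exact ⟨⟨a, hx⟩, rfl⟩
  have hle : f.ker ≤ (g.comp f).ker := fun a ha ↦ by
    rw [AddMonoidHom.mem_ker] at ha
    rw [AddMonoidHom.mem_ker, AddMonoidHom.comp_apply, ha, map_zero]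
  have hker : φ.ker = f.ker.addSubgroupOf (g.comp f).ker := by
    ext ⟨a, ha⟩
    rw [AddMonoidHom.mem_ker, AddSubgroup.mem_addSubgroupOf, AddMonoidHom.mem_ker]
    rfl
  rw [natCard_eq_card_ker_mul_card_range φ, hker, hrange,
    Nat.card_congr (AddSubgroup.addSubgroupOfEquivOfLe hle).toEquiv]

/-- `#(H ∩ K) · (K : H ∩ K) = #K`. [folklore] -/
theorem natCard_inf_mul_relIndex (H K : AddSubgroup A) :
    Nat.card ↥(H ⊓ K) * H.relIndex K = Nat.card K := by
  rw [← Nat.card_congr (AddSubgroup.addSubgroupOfEquivOfLe (inf_le_right : H ⊓ K ≤ K)).toEquiv,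
    AddSubgroup.inf_addSubgroupOf_right]
  exact AddSubgroup.card_mul_index _

/-- `(A : im (g ∘ f)) · #ker g = (A : im g) · (A : im f) · #(ker g ∩ im f)` (index calculus:
`im (g ∘ f) = g(im f)`, `(A : g H) = (A : H + ker g) (A : im g)`). [folklore] -/
theorem index_range_comp_mul (f g : A →+ A) :
    (g.comp f).range.index * Nat.card g.ker =
      g.range.index * f.range.index * Nat.card ↥(g.ker ⊓ f.range) := by
  have h1 : (g.comp f).range.index = (f.range ⊔ g.ker).index * g.range.index := by
    rw [← AddMonoidHom.map_range, AddSubgroup.index_map]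
  have h2 : f.range.index = f.range.relIndex g.ker * (f.range ⊔ g.ker).index := by
    rw [← AddSubgroup.relIndex_sup_left, AddSubgroup.relIndex_mul_index le_sup_left]
  have h3 : Nat.card ↥(f.range ⊓ g.ker) * f.range.relIndex g.ker = Nat.card g.ker :=
    natCard_inf_mul_relIndex f.range g.ker
  rw [h1, h2, inf_comm, ← h3]
  ring

/-- **Multiplicativity**: `N(g ∘ f) = N(g) N(f)` for endomorphisms with finite kernel and
cokernel, and `g ∘ f` again has finite kernel and cokernel (the six-term kernel–cokernel
sequence, counted). [folklore] -/
theorem kerCokerRatio_comp {f g : A →+ A} (hf : FinKerCoker f) (hg : FinKerCoker g) :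
    FinKerCoker (g.comp f) ∧ kerCokerRatio (g.comp f) = kerCokerRatio g * kerCokerRatio f := by
  have hI : Nat.card ↥(g.ker ⊓ f.range) ≠ 0 := by
    haveI : Finite g.ker := Nat.finite_of_card_ne_zero hg.card_ker_ne_zero
    haveI : Finite ↥(g.ker ⊓ f.range) :=
      Finite.of_injective _ (AddSubgroup.inclusion_injective (inf_le_left : g.ker ⊓ f.range ≤ g.ker))
    exact Nat.card_pos.ne'
  have hk := natCard_ker_comp f g
  have hi := index_range_comp_mul f g
  have hk0 : Nat.card (g.comp f).ker ≠ 0 := by rw [hk]; exact mul_ne_zero hf.card_ker_ne_zero hI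
  have hi0 : (g.comp f).range.index ≠ 0 := by
    intro h0
    rw [h0, zero_mul] at hi
    exact mul_ne_zero (mul_ne_zero hg.index_ne_zero hf.index_ne_zero) hI hi.symm
  refine ⟨⟨hk0, hi0⟩, ?_⟩
  unfold kerCokerRatio
  rw [div_mul_div_comm, div_eq_div_iff (Nat.cast_ne_zero.mpr hi0)
    (mul_ne_zero (Nat.cast_ne_zero.mpr hg.index_ne_zero) (Nat.cast_ne_zero.mpr hf.index_ne_zero))]
  have hk' : (Nat.card (g.comp f).ker : ℚ) = Nat.card f.ker * Nat.card ↥(g.ker ⊓ f.range) := by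
    exact_mod_cast hk
  have hi' : ((g.comp f).range.index : ℚ) * Nat.card g.ker =
      g.range.index * f.range.index * Nat.card ↥(g.ker ⊓ f.range) := by
    exact_mod_cast hi
  rw [hk']
  linear_combination (-(Nat.card f.ker : ℚ)) * hi'

/-- An automorphism has `N = 1`. [folklore] -/
theorem kerCokerRatio_of_bijective {f : A →+ A} (hf : Bijective f) :
    FinKerCoker f ∧ kerCokerRatio f = 1 := by
  have hk : f.ker = ⊥ := (AddMonoidHom.ker_eq_bot_iff f).mpr hf.1
  have hr : f.range = ⊤ := AddMonoidHom.range_eq_top.mpr hf.2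
  have h1 : Nat.card f.ker = 1 := by rw [hk]; exact AddSubgroup.card_bot
  have h2 : f.range.index = 1 := by rw [hr, AddSubgroup.index_top]
  refine ⟨⟨?_, ?_⟩, ?_⟩
  · rw [h1]; exact one_ne_zero
  · rw [h2]; exact one_ne_zero
  · unfold kerCokerRatio
    rw [h1, h2, Nat.cast_one, div_one]

/-- `N` only depends on the underlying function. [folklore] -/
theorem kerCokerRatio_congr {f g : A →+ A} (h : f = g) : kerCokerRatio f = kerCokerRatio g := by
  subst h; rfl

end KerCoker

/-! ## Endomorphisms killed by `Φ_p`: the factorisation of `p` -/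

section Cyclotomic

variable {p : ℕ} [hp : Fact p.Prime]

/-- `e_k = 1 + X + ⋯ + X^{k-1} ∈ ℤ[X]`. [folklore] -/
def geomPoly (k : ℕ) : ℤ[X] :=
  ∑ i ∈ range k, X ^ i

omit hp in
/-- `e_{p-k} + X^{p-k} e_k = e_p (= Φ_p)` for `k ≤ p`. [folklore] -/
theorem geomPoly_add_pow_mul_geomPoly {k : ℕ} (hk : k ≤ p) :
    geomPoly (p - k) + X ^ (p - k) * geomPoly k = geomPoly p := by
  unfold geomPoly
  have hp' : p = (p - k) + k := (Nat.sub_add_cancel hk).symm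
  conv_rhs => rw [hp', Finset.sum_range_add]
  rw [Finset.mul_sum]
  congr 1
  exact Finset.sum_congr rfl fun i _ ↦ (pow_add X (p - k) i).symm

/-- **Gauss**: `Φ_p ∣ ∏_{k=1}^{p-1} (1 - X^k) - p` in `ℤ[X]` (evaluate at a primitive `p`-th
root of unity `ζ`, where `∏_{k=1}^{p-1} (1 - ζ^k) = Φ_p(1) = p`, and use that `Φ_p` is the
minimal polynomial of `ζ` over the integrally closed `ℤ`). [folklore] -/
theorem cyclotomic_dvd_prod_one_sub_pow_sub_natCast :
    cyclotomic p ℤ ∣ (∏ k ∈ range (p - 1), (1 - X ^ (k + 1))) - (p : ℤ[X]) := by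
  have hζ : IsPrimitiveRoot (Complex.exp (2 * Real.pi * Complex.I / p)) p :=
    Complex.isPrimitiveRoot_exp p hp.out.ne_zero
  set ζ := Complex.exp (2 * Real.pi * Complex.I / p) with hζdef
  have hζ' : IsPrimitiveRoot ζ (p - 1 + 1) := by rwa [Nat.sub_add_cancel hp.out.one_le]
  have hprod := hζ'.prod_one_sub_pow_eq_order
  have hroot : aeval ζ ((∏ k ∈ range (p - 1), (1 - X ^ (k + 1))) - (p : ℤ[X])) = 0 := by
    rw [map_sub, map_prod, map_natCast]
    simp only [map_sub, map_one, map_pow, aeval_X]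
    rw [hprod, sub_eq_zero]
    exact_mod_cast Nat.sub_add_cancel hp.out.one_le
  rw [cyclotomic_eq_minpoly hζ hp.out.pos]
  exact minpoly.isIntegrallyClosed_dvd (hζ.isIntegral hp.out.pos) hroot

omit hp in
/-- `∏_{k=1}^{p-1} (1 - X^k) = (1 - X)^{p-1} ∏_{k=1}^{p-1} e_k`. [folklore] -/
theorem prod_one_sub_pow_eq :
    ∏ k ∈ range (p - 1), (1 - X ^ (k + 1) : ℤ[X]) =
      (1 - X) ^ (p - 1) * ∏ k ∈ range (p - 1), geomPoly (k + 1) := by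
  rw [← Finset.card_range (p - 1), ← Finset.prod_const, Finset.card_range, ← Finset.prod_mul_distrib]
  exact Finset.prod_congr rfl fun k _ ↦ (mul_neg_geom_sum X (k + 1)).symm

variable {A : Type*} [AddCommGroup A]

/-- **The factorisation of `p` on a `ℤ[C_p]/(Φ_p)`-module.** If `Φ_p(c) = 1 + c + ⋯ + c^{p-1} = 0`
in `End(A)` then `p = (1 - c)^{p-1} ∏_{k=1}^{p-1} e_k(c)` in `End(A)`. [folklore] -/
theorem natCast_eq_aeval_of_geom_sum_eq_zero (c : Module.End ℤ A)
    (hc : ∑ i ∈ range p, c ^ i = 0) :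
    (p : Module.End ℤ A) =
      aeval c ((1 - X) ^ (p - 1) * ∏ k ∈ range (p - 1), geomPoly (k + 1)) := by
  obtain ⟨Q, hQ⟩ := cyclotomic_dvd_prod_one_sub_pow_sub_natCast (p := p)
  rw [prod_one_sub_pow_eq, sub_eq_iff_eq_add] at hQ
  have hΦ : aeval c (cyclotomic p ℤ) = 0 := by
    rw [cyclotomic_prime, map_sum]
    simpa only [map_pow, aeval_X] using hc
  have h := congrArg (aeval c) hQ
  simp only [map_add, map_mul, hΦ, zero_mul, zero_add, map_natCast] at h
  rw [map_mul]
  exact h.symm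

omit hp in
/-- `e_{p-k}(c) = -c^{p-k} e_k(c)` when `Φ_p(c) = 0` (`1 ≤ k ≤ p - 1`… indeed for all `k ≤ p`).
[folklore] -/
theorem aeval_geomPoly_sub_eq (c : Module.End ℤ A) (hc : ∑ i ∈ range p, c ^ i = 0) {k : ℕ}
    (hk : k ≤ p) :
    aeval c (geomPoly (p - k)) = -(c ^ (p - k)) * aeval c (geomPoly k) := by
  have h := congrArg (aeval c) (geomPoly_add_pow_mul_geomPoly (p := p) hk)
  have hΦ : aeval c (geomPoly p) = 0 := by
    unfold geomPoly
    rw [map_sum]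
    simpa only [map_pow, aeval_X] using hc
  rw [map_add, map_mul, map_pow, aeval_X, hΦ, add_eq_zero_iff_eq_neg] at h
  rw [h, neg_mul]

/-- `c` is invertible when `Φ_p(c) = 0`: `c · (-(e_{p-1}(c))) = 1 = (-(e_{p-1}(c))) · c`.
[folklore] -/
theorem isUnit_of_geom_sum_eq_zero (c : Module.End ℤ A) (hc : ∑ i ∈ range p, c ^ i = 0) :
    IsUnit c := by
  have hp1 : p = (p - 1) + 1 := (Nat.sub_add_cancel hp.out.one_le).symm
  have key : c * (∑ i ∈ range (p - 1), c ^ i) + 1 = 0 := by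
    rw [hp1, Finset.sum_range_succ', pow_zero] at hc
    rw [Finset.mul_sum]
    simpa only [pow_succ'] using hc
  have key' : (∑ i ∈ range (p - 1), c ^ i) * c + 1 = 0 := by
    rw [← key, Finset.sum_mul, Finset.mul_sum]
    congr 1
    exact Finset.sum_congr rfl fun i _ ↦ by rw [← pow_succ, ← pow_succ']
  rw [add_eq_zero_iff_eq_neg] at key key'
  refine ⟨⟨c, -(∑ i ∈ range (p - 1), c ^ i), ?_, ?_⟩, rfl⟩
  · rw [mul_neg, key, neg_neg]
  · rw [neg_mul, key', neg_neg]

end Cyclotomic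

/-! ## Counting: `p ^ zpCorank` is a rational square -/

section Count

variable {A : Type*} [AddCommGroup A] {p : ℕ} [hp : Fact p.Prime]

omit hp in
/-- The kernel of multiplication by `p` is `A[p]`. [folklore] -/
theorem ker_natCast_end :
    ((p : Module.End ℤ A)).toAddMonoidHom.ker = A[(p : ℤ)] := by
  ext a
  rw [AddMonoidHom.mem_ker, AddSubgroup.torsionBy.nsmul_iff]
  rfl

omit hp in
/-- The image of multiplication by `p` is `pA`. [folklore] -/
theorem range_natCast_end :
    ((p : Module.End ℤ A)).toAddMonoidHom.range =
      (LinearMap.range (LinearMap.lsmul ℤ A p)).toAddSubgroup := by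
  ext x
  simp only [AddMonoidHom.mem_range, LinearMap.toAddMonoidHom_coe, Module.End.natCast_apply,
    Submodule.mem_toAddSubgroup, LinearMap.mem_range, LinearMap.lsmul_apply, natCast_zsmul]

omit hp in
/-- `(A : pA) = #(A/pA)`. [folklore] -/
theorem index_range_natCast_end :
    ((p : Module.End ℤ A)).toAddMonoidHom.range.index = Nat.card (ModN A p) := by
  rw [range_natCast_end, AddSubgroup.index_eq_card]
  rfl

/-- **`N(p) = p ^ zpCorank A p`** for a `p`-primary group with finite `p`-torsion
(`#A[p] = p ^ zpCorank · #(A/pA)`). [folklore] -/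
theorem kerCokerRatio_natCast (hA : ∀ a : A, ∃ n : ℕ, p ^ n • a = 0) [Finite A[(p : ℤ)]] :
    FinKerCoker ((p : Module.End ℤ A)).toAddMonoidHom ∧
      kerCokerRatio ((p : Module.End ℤ A)).toAddMonoidHom = (p : ℚ) ^ zpCorank A p := by
  obtain ⟨hfin, -⟩ := finite_modN_of_primary hA
  haveI := hfin
  have hk : Nat.card ((p : Module.End ℤ A)).toAddMonoidHom.ker = Nat.card A[(p : ℤ)] := by
    rw [ker_natCast_end]
  have hcount := pow_zpCorank_mul_natCard_modN (p := p) hA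
  refine ⟨⟨by rw [hk]; exact Nat.card_pos.ne', by rw [index_range_natCast_end]; exact Nat.card_pos.ne'⟩, ?_⟩
  unfold kerCokerRatio
  rw [hk, index_range_natCast_end, div_eq_iff (Nat.cast_ne_zero.mpr Nat.card_pos.ne')]
  exact_mod_cast hcount.symm

omit hp in
/-- A factor of `p`: if `F G = p = G F` in `End(A)` then `F` has finite kernel (`⊆ A[p]`) and
cokernel (`F A ⊇ pA`). [folklore] -/
theorem finKerCoker_of_mul_eq_natCast (hA : ∀ a : A, ∃ n : ℕ, p ^ n • a = 0) [Finite A[(p : ℤ)]]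
    {F G : Module.End ℤ A} (hFG : F * G = (p : Module.End ℤ A))
    (hGF : G * F = (p : Module.End ℤ A)) : FinKerCoker F.toAddMonoidHom := by
  obtain ⟨hfin, -⟩ := finite_modN_of_primary hA
  haveI := hfin
  constructor
  · have hle : F.toAddMonoidHom.ker ≤ A[(p : ℤ)] := by
      intro a ha
      rw [AddMonoidHom.mem_ker, LinearMap.toAddMonoidHom_coe] at ha
      rw [AddSubgroup.torsionBy.nsmul_iff]
      have h0 : ((p : Module.End ℤ A)) a = 0 := by rw [← hGF, Module.End.mul_apply, ha, map_zero]
      simpa only [Module.End.natCast_apply] using h0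
    haveI : Finite F.toAddMonoidHom.ker := Finite.of_injective _ (AddSubgroup.inclusion_injective hle)
    exact Nat.card_pos.ne'
  · have hle : ((p : Module.End ℤ A)).toAddMonoidHom.range ≤ F.toAddMonoidHom.range := by
      rintro x ⟨a, rfl⟩
      refine ⟨G a, ?_⟩
      rw [LinearMap.toAddMonoidHom_coe, LinearMap.toAddMonoidHom_coe, ← Module.End.mul_apply, hFG]
    have hdvd := AddSubgroup.index_dvd_of_le hle
    rw [index_range_natCast_end] at hdvd
    exact fun h0 ↦ Nat.card_pos.ne' (Nat.eq_zero_of_zero_dvd (h0 ▸ hdvd))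

/-- `N` of the evaluation of a polynomial at `c`. [folklore] -/
def polyRatio (c : Module.End ℤ A) (P : ℤ[X]) : ℚ :=
  kerCokerRatio (aeval c P).toAddMonoidHom

/-- `(F G).toAddMonoidHom = F ∘ G`. [folklore] -/
theorem toAddMonoidHom_mul (F G : Module.End ℤ A) :
    (F * G).toAddMonoidHom = F.toAddMonoidHom.comp G.toAddMonoidHom :=
  rfl

/-- Multiplicativity of `polyRatio` on products of polynomials, with finiteness. [folklore] -/
theorem polyRatio_mul (c : Module.End ℤ A) {P Q : ℤ[X]}
    (hP : FinKerCoker (aeval c P).toAddMonoidHom) (hQ : FinKerCoker (aeval c Q).toAddMonoidHom) :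
    FinKerCoker (aeval c (P * Q)).toAddMonoidHom ∧
      polyRatio c (P * Q) = polyRatio c P * polyRatio c Q := by
  unfold polyRatio
  rw [map_mul, toAddMonoidHom_mul]
  exact kerCokerRatio_comp hQ hP

/-- Every polynomial factor of `(1 - X)^{p-1} ∏ e_k` has finite kernel and cokernel at `c`.
[folklore] -/
theorem finKerCoker_of_dvd (hA : ∀ a : A, ∃ n : ℕ, p ^ n • a = 0) [Finite A[(p : ℤ)]]
    (c : Module.End ℤ A) (hc : ∑ i ∈ range p, c ^ i = 0) {P : ℤ[X]}
    (hP : P ∣ (1 - X) ^ (p - 1) * ∏ k ∈ range (p - 1), geomPoly (k + 1)) :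
    FinKerCoker (aeval c P).toAddMonoidHom := by
  obtain ⟨Q, hQ⟩ := hP
  have hp' := natCast_eq_aeval_of_geom_sum_eq_zero c hc
  rw [hQ] at hp'
  refine finKerCoker_of_mul_eq_natCast hA (G := aeval c Q) ?_ ?_
  · rw [← map_mul, ← hp']
  · rw [← map_mul, mul_comm, ← hp']

/-- Multiplicativity of `polyRatio` over a finite product of factors of
`(1 - X)^{p-1} ∏ e_k`. [folklore] -/
theorem polyRatio_prod (hA : ∀ a : A, ∃ n : ℕ, p ^ n • a = 0) [Finite A[(p : ℤ)]]
    (c : Module.End ℤ A) (hc : ∑ i ∈ range p, c ^ i = 0) (P : ℕ → ℤ[X]) (m : ℕ)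
    (hP : ∏ i ∈ range m, P i ∣ (1 - X) ^ (p - 1) * ∏ k ∈ range (p - 1), geomPoly (k + 1)) :
    FinKerCoker (aeval c (∏ i ∈ range m, P i)).toAddMonoidHom ∧
      polyRatio c (∏ i ∈ range m, P i) = ∏ i ∈ range m, polyRatio c (P i) := by
  induction m with
  | zero =>
    simp only [Finset.prod_range_zero, polyRatio, map_one]
    have h1 : Bijective (1 : Module.End ℤ A).toAddMonoidHom := bijective_id
    exact ⟨(kerCokerRatio_of_bijective h1).1, (kerCokerRatio_of_bijective h1).2⟩
  | succ m ih =>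
    rw [Finset.prod_range_succ] at hP
    have ih' := ih ((dvd_mul_right _ _).trans hP)
    have hPm : FinKerCoker (aeval c (P m)).toAddMonoidHom :=
      finKerCoker_of_dvd hA c hc ((dvd_mul_left _ _).trans hP)
    rw [Finset.prod_range_succ, Finset.prod_range_succ]
    obtain ⟨h1, h2⟩ := polyRatio_mul c ih'.1 hPm
    exact ⟨h1, by rw [h2, ih'.2]⟩

/-- `N(e_{p-k}(c)) = N(e_k(c))` (`e_{p-k}(c) = -c^{p-k} e_k(c)` with `-c^{p-k}` an
automorphism). [folklore] -/
theorem polyRatio_geomPoly_sub (hA : ∀ a : A, ∃ n : ℕ, p ^ n • a = 0) [Finite A[(p : ℤ)]]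
    (c : Module.End ℤ A) (hc : ∑ i ∈ range p, c ^ i = 0) {k : ℕ} (hk1 : 1 ≤ k) (hk : k ≤ p - 1) :
    polyRatio c (geomPoly (p - k)) = polyRatio c (geomPoly k) := by
  have hkp : k ≤ p := hk.trans (Nat.sub_le p 1)
  have hu : IsUnit (-(c ^ (p - k))) := ((isUnit_of_geom_sum_eq_zero c hc).pow (p - k)).neg
  have hbij : Bijective (-(c ^ (p - k))).toAddMonoidHom :=
    (Module.End.isUnit_iff _).mp hu
  have hek : FinKerCoker (aeval c (geomPoly k)).toAddMonoidHom := by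
    refine finKerCoker_of_dvd hA c hc (Dvd.dvd.mul_left ?_ _)
    have hmem : k - 1 ∈ range (p - 1) := Finset.mem_range.mpr (by omega)
    have e : geomPoly k = geomPoly (k - 1 + 1) := by rw [Nat.sub_add_cancel hk1]
    rw [e]
    exact Finset.dvd_prod_of_mem (fun i ↦ geomPoly (i + 1)) hmem
  unfold polyRatio
  rw [aeval_geomPoly_sub_eq c hc hkp, toAddMonoidHom_mul]
  rw [(kerCokerRatio_comp hek (kerCokerRatio_of_bijective hbij).1).2,
    (kerCokerRatio_of_bijective hbij).2, one_mul]

/-- **`p ^ zpCorank A p` is the square of a rational number** when `Φ_p(c) = 0` on the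
`p`-primary group `A` with finite `p`-torsion and `p` is odd. [folklore] -/
theorem exists_sq_eq_pow_zpCorank (hA : ∀ a : A, ∃ n : ℕ, p ^ n • a = 0) [Finite A[(p : ℤ)]]
    (hp2 : p ≠ 2) (c : Module.End ℤ A) (hc : ∑ i ∈ range p, c ^ i = 0) :
    ∃ M : ℚ, M ≠ 0 ∧ (p : ℚ) ^ zpCorank A p = M ^ 2 := by
  -- `p - 1 = 2 m`
  obtain ⟨m, hm⟩ : ∃ m, p - 1 = m + m := hp.out.even_sub_one hp2
  -- `N(p) = N((1 - X)^{p-1} ∏ e_k)`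
  have hNp : polyRatio c ((1 - X) ^ (p - 1) * ∏ k ∈ range (p - 1), geomPoly (k + 1)) =
      (p : ℚ) ^ zpCorank A p := by
    unfold polyRatio
    rw [← natCast_eq_aeval_of_geom_sum_eq_zero c hc]
    exact (kerCokerRatio_natCast hA).2
  -- powers of `1 - X`
  have hpow := polyRatio_prod hA c hc (fun _ ↦ (1 - X : ℤ[X])) (p - 1)
    (by rw [Finset.prod_const, Finset.card_range]; exact dvd_mul_right _ _)
  simp only [Finset.prod_const, Finset.card_range] at hpow
  -- the product of the `e_k`
  have hprodE := polyRatio_prod hA c hc (fun k ↦ geomPoly (k + 1)) (p - 1) (dvd_mul_left _ _)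
  have hsplit := (polyRatio_mul c hpow.1 hprodE.1).2
  -- pairing `k ↔ p - k`
  have hpair : ∏ i ∈ range (p - 1), polyRatio c (geomPoly (i + 1)) =
      (∏ i ∈ range m, polyRatio c (geomPoly (i + 1))) ^ 2 := by
    rw [hm, Finset.prod_range_add, sq]
    congr 1
    rw [← Finset.prod_range_reflect (fun i ↦ polyRatio c (geomPoly (i + 1))) m]
    refine Finset.prod_congr rfl fun i hi ↦ ?_
    have hi' := Finset.mem_range.mp hi
    have e : m + i + 1 = p - (m - 1 - i + 1) := by omega
    rw [e]
    exact polyRatio_geomPoly_sub hA c hc (by omega) (by omega)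
  have hz : (p : ℚ) ^ zpCorank A p ≠ 0 := pow_ne_zero _ (Nat.cast_ne_zero.mpr hp.out.ne_zero)
  have hkey : (p : ℚ) ^ zpCorank A p =
      (polyRatio c (1 - X) ^ m * ∏ i ∈ range m, polyRatio c (geomPoly (i + 1))) ^ 2 := by
    rw [← hNp, hsplit, hpow.2, hprodE.2, hpair, hm, pow_add]
    ring
  refine ⟨polyRatio c (1 - X) ^ m * ∏ i ∈ range m, polyRatio c (geomPoly (i + 1)), ?_, hkey⟩
  intro h0
  rw [hkey, h0] at hz
  exact hz (by ring)

/-- **The corank of a `ℤ[ζ_p]`-module is even** (`p` odd): if `A` is `p`-primary with finite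
`p`-torsion and an additive endomorphism `c` satisfies `1 + c + ⋯ + c^{p-1} = 0`, then
`zpCorank A p` is even. (Dokchitser–Dokchitser 2010, Cor. 4.15: "A cyclic group of order `p` has
only two `ℚ_p`-irreducible `p`-adic representations, the trivial one and one of dimension
`p − 1`"; here for the non-trivial isotypic part.) [cite: DokchitserDokchitserAnnals2010, Cor. 4.15] -/
theorem even_zpCorank_of_geom_sum_eq_zero (hA : ∀ a : A, ∃ n : ℕ, p ^ n • a = 0)
    [Finite A[(p : ℤ)]] (hp2 : p ≠ 2) (c : A →+ A)
    (hc : ∀ a : A, ∑ i ∈ range p, (c.toIntLinearMap ^ i) a = 0) : Even (zpCorank A p) := by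
  have hc' : ∑ i ∈ range p, c.toIntLinearMap ^ i = 0 := by
    ext a
    rw [LinearMap.zero_apply, ← hc a]
    induction (range p) using Finset.cons_induction with
    | empty => simp
    | cons j t hj ih => rw [Finset.sum_cons, Finset.sum_cons, LinearMap.add_apply, ih]
  obtain ⟨M, hM, hsq⟩ := exists_sq_eq_pow_zpCorank hA hp2 c.toIntLinearMap hc'
  have hv := congrArg (padicValRat p) hsq
  rw [padicValRat.pow, padicValRat.pow, padicValRat.self hp.out.one_lt, mul_one] at hv
  have hv' : (zpCorank A p : ℤ) = 2 * padicValRat p M := by exact_mod_cast hv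
  have heven : Even ((zpCorank A p : ℤ)) := ⟨padicValRat p M, by rw [hv']; ring⟩
  exact (Int.even_coe_nat _).mp heven

end Count

/-! ## Invariants of an automorphism of order `p` -/

section Invariants

variable {A : Type*} [AddCommGroup A] {p : ℕ} [hp : Fact p.Prime]

/-- **`zpCorank A ≡ zpCorank A^{⟨c⟩} (mod 2)`** for an additive endomorphism `c` with `c^p = 1`
of a `p`-primary group `A` with finite `p`-torsion, `p` odd: along
`0 → ker (1 - c) → A → (1 - c) A → 0` the corank is additive (`zpCorank_eq_add_of_shortExact`),
and `(1 - c) A` is killed by `Φ_p(c)` (`Φ_p(c) (1 - c) = 1 - c^p = 0`), so its corank is even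
(`even_zpCorank_of_geom_sum_eq_zero`). The invariants are any subgroup `K` with
`a ∈ K ↔ c a = a`. (Dokchitser–Dokchitser 2010, Lemma 4.14 / Cor. 4.15:
`dim X_p(E/F) ≡ dim X_p(E/F)^G (mod 2)` for `G` cyclic of order `p`.)
[cite: DokchitserDokchitserAnnals2010, Cor. 4.15] -/
theorem zpCorank_mod_two_eq_of_pow_eq_id (hA : ∀ a : A, ∃ n : ℕ, p ^ n • a = 0)
    [Finite A[(p : ℤ)]] (hp2 : p ≠ 2) (c : A →+ A) (hcp : ∀ a, (c.toIntLinearMap ^ p) a = a)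
    (K : AddSubgroup A) (hK : ∀ a, a ∈ K ↔ c a = a) :
    zpCorank A p % 2 = zpCorank K p % 2 := by
  set C := c.toIntLinearMap with hC
  set D : Module.End ℤ A := 1 - C with hD
  -- `C` preserves `(1 - C) A`
  have hCD : C * D = D * C := by simp only [hD, mul_sub, sub_mul, mul_one, one_mul]
  have hmap : ∀ b ∈ LinearMap.range D, C b ∈ LinearMap.range D := by
    rintro _ ⟨a, rfl⟩
    exact ⟨C a, by rw [← Module.End.mul_apply, ← hCD, Module.End.mul_apply]⟩
  set cB : LinearMap.range D →+ LinearMap.range D := (C.restrict hmap).toAddMonoidHom with hcB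
  -- the short exact sequence `0 → ker D → A → range D → 0`
  have hadd : zpCorank A p =
      zpCorank (LinearMap.ker D) p + zpCorank (LinearMap.range D) p :=
    zpCorank_eq_add_of_shortExact (i := (LinearMap.ker D).subtype.toAddMonoidHom)
      (f := D.rangeRestrict.toAddMonoidHom) Subtype.val_injective
      (LinearMap.surjective_rangeRestrict D)
      (fun a ha ↦ ⟨⟨a, by simpa [Subtype.ext_iff] using ha⟩, rfl⟩)
      (fun x ↦ Subtype.ext (LinearMap.mem_ker.mp x.2)) hA
  -- `range D` is `p`-primary with finite `p`-torsion
  have hB : ∀ b : LinearMap.range D, ∃ n : ℕ, p ^ n • b = 0 := fun b ↦ by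
    obtain ⟨n, hn⟩ := hA b
    exact ⟨n, Subtype.ext (by simpa using hn)⟩
  have hmemp : ∀ x : (LinearMap.range D)[(p : ℤ)], ((x : LinearMap.range D) : A) ∈ A[(p : ℤ)] := by
    intro x
    have hx := congrArg Subtype.val (AddSubgroup.torsionBy.nsmul_iff.mp x.2)
    rw [AddSubgroup.torsionBy.nsmul_iff]
    simpa using hx
  haveI : Finite (LinearMap.range D)[(p : ℤ)] :=
    Finite.of_injective (fun x : (LinearMap.range D)[(p : ℤ)] ↦ (⟨_, hmemp x⟩ : A[(p : ℤ)]))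
      fun x y h ↦ Subtype.ext (Subtype.ext (Subtype.mk.inj h))
  -- `Φ_p(c) = 0` on `range D`
  have hpow : ∀ (i : ℕ) (b : LinearMap.range D),
      (((cB.toIntLinearMap ^ i) b : LinearMap.range D) : A) = (C ^ i) (b : A) := by
    intro i
    induction i with
    | zero => intro b; simp
    | succ i ih =>
      intro b
      rw [pow_succ, pow_succ, Module.End.mul_apply, Module.End.mul_apply, ih]
      rfl
  have hc : ∀ b : LinearMap.range D, ∑ i ∈ range p, (cB.toIntLinearMap ^ i) b = 0 := by
    intro b
    obtain ⟨a, ha⟩ := b.2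
    apply Subtype.ext
    rw [AddSubmonoidClass.coe_finsetSum, Finset.sum_congr rfl fun i _ ↦ hpow i b,
      ← LinearMap.sum_apply, ← ha, ← Module.End.mul_apply, hD, geom_sum_mul_neg,
      LinearMap.sub_apply, Module.End.one_apply, hcp, sub_self]
    rfl
  have heven : Even (zpCorank (LinearMap.range D) p) :=
    even_zpCorank_of_geom_sum_eq_zero hB hp2 cB hc
  -- the invariants
  have hK' : (LinearMap.ker D).toAddSubgroup = K := by
    ext a
    rw [Submodule.mem_toAddSubgroup, LinearMap.mem_ker, hK, hD, LinearMap.sub_apply,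
      Module.End.one_apply, sub_eq_zero, eq_comm]
    rfl
  have hker : zpCorank (LinearMap.ker D) p = zpCorank K p := by
    rw [← hK']
    rfl
  rw [hadd, hker, Nat.add_mod, Nat.even_iff.mp heven, add_zero, Nat.mod_mod]

end Invariants

end Literature.NumberTheory.EllipticCurves
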